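import Mathlib.Analysis.Convex.Basic
import Mathlib.Topology.MetricSpace.Sequences
import Mathlib.Topology.Algebra.Module.FiniteDimension
import Mathlib.Analysis.Normed.Module.FiniteDimension
import Mathlib.Algebra.BigOperators.Field
import HarnessLib

/-!
# The Euclidean nearest-point retraction onto a compact convex subset of `ℝⁿ`

Proof file (theorems only). For a non-empty compact convex `K ⊆ ℝⁿ` (`Fin n → ℝ`, any norm — we use
the explicit squared Euclidean distance `D(x, y) = ∑ᵢ (xᵢ - yᵢ)²`, not the ambient sup metric) the
nearest point `r(x) ∈ K` (the unique minimiser of `D(x, ·)` on `K`) exists, fixes `K` pointwise and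
depends continuously on `x`: a continuous retraction `ℝⁿ → K` CHARACTERISED BY A FIRST-ORDER
CONDITION (`y = r x ↔ y ∈ K ∧ ∀ z ∈ K, D(x,y) ≤ D(x,z)`), hence definable whenever `K` is, in any
expansion of the real field. Consequence: a continuous function on `K` extends to a continuous
function on `ℝⁿ`, `f ∘ r`, by a formula — the extension step of van den Dries' triangulation theorem
(Ch. 8 (2.1)–(2.3): continuous definable functions on a closed simplex extend continuously and
definably), for which the tree's semialgebraic instance used a semialgebraic Tietze theorem instead.

## Main statements (all proved)

* `sqDist`-free spelling: all statements use `∑ i, (x i - y i) ^ 2` literally.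
* `sum_sq_midpoint` — the parallelogram identity for the midpoint.
* `exists_isMinOn_sum_sq`, `eq_of_isMinOn_sum_sq` — existence (compactness) and uniqueness
  (strict convexity) of the nearest point.
* `exists_nearestPoint_retraction` — **the continuous nearest-point retraction** `r : ℝⁿ → K` with
  its first-order characterisation.
* `exists_continuous_extension_of_isCompact_convex` — continuous extension `f ∘ r` of a function
  continuous on `K`.

## References

* [Dries1998] L. van den Dries, *Tame topology and o-minimal structures* (1998), Ch. 8 (2.1)–(2.3)
  (the extension step these lemmas replace, read in the held copy, p. 127).
-/

noncomputable section

open Set Filter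
open _root_.Topology

namespace Literature.Analysis.Convexity

variable {n : ℕ}

/-! ### The squared Euclidean distance -/

/-- Continuity of `(x, y) ↦ ∑ (xᵢ - yᵢ)²` in `y`. [folklore] -/
theorem continuous_sum_sq_sub (x : Fin n → ℝ) : Continuous fun y : Fin n → ℝ => ∑ i, (x i - y i) ^ 2 := by
  fun_prop

/-- `∑ (xᵢ - yᵢ)² = 0 ↔ x = y`. [folklore] -/
theorem sum_sq_sub_eq_zero_iff (x y : Fin n → ℝ) : ∑ i, (x i - y i) ^ 2 = 0 ↔ x = y := by
  rw [Finset.sum_eq_zero_iff_of_nonneg fun i _ => sq_nonneg (x i - y i)]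
  constructor
  · intro h
    funext i
    have := h i (Finset.mem_univ i)
    nlinarith [sq_nonneg (x i - y i)]
  · rintro rfl i _
    simp

/-- Continuity of `x ↦ ∑ (xᵢ - zᵢ)²`. [folklore] -/
theorem continuous_sum_sq_sub_left (z : Fin n → ℝ) :
    Continuous fun x : Fin n → ℝ => ∑ i, (x i - z i) ^ 2 := by
  fun_prop

/-- Joint continuity of `(x, y) ↦ ∑ (xᵢ - yᵢ)²`. [folklore] -/
theorem continuous_sum_sq_sub_prod :
    Continuous fun p : (Fin n → ℝ) × (Fin n → ℝ) => ∑ i, (p.1 i - p.2 i) ^ 2 :=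
  continuous_finsetSum _ fun i _ =>
    (((continuous_apply i).comp continuous_fst).sub ((continuous_apply i).comp continuous_snd)).pow 2

/-- Limits of `∑ (uₖᵢ - vₖᵢ)²` along convergent sequences. [folklore] -/
theorem tendsto_sum_sq_of_tendsto {u v : ℕ → Fin n → ℝ} {x y : Fin n → ℝ}
    (hu : Tendsto u atTop (𝓝 x)) (hv : Tendsto v atTop (𝓝 y)) :
    Tendsto (fun k => ∑ i, (u k i - v k i) ^ 2) atTop (𝓝 (∑ i, (x i - y i) ^ 2)) := by
  have hu' := tendsto_pi_nhds.1 hu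
  have hv' := tendsto_pi_nhds.1 hv
  exact tendsto_finsetSum _ fun i _ => ((hu' i).sub (hv' i)).pow 2

/-- **Parallelogram identity for the midpoint**:
`D(x, (y+y')/2) = D(x,y)/2 + D(x,y')/2 - D(y,y')/4`. [folklore] -/
theorem sum_sq_midpoint (x y y' : Fin n → ℝ) :
    ∑ i, (x i - ((1 / 2 : ℝ) • y + (1 / 2 : ℝ) • y') i) ^ 2 =
      (∑ i, (x i - y i) ^ 2) / 2 + (∑ i, (x i - y' i) ^ 2) / 2 - (∑ i, (y i - y' i) ^ 2) / 4 := by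
  rw [Finset.sum_div, Finset.sum_div, Finset.sum_div, ← Finset.sum_add_distrib,
    ← Finset.sum_sub_distrib]
  refine Finset.sum_congr rfl fun i _ => ?_
  simp only [Pi.add_apply, Pi.smul_apply, smul_eq_mul]
  ring

/-! ### Existence and uniqueness of the nearest point -/

/-- A continuous function attains its minimum on a non-empty compact set: the nearest point exists.
[folklore] -/
theorem exists_isMinOn_sum_sq {K : Set (Fin n → ℝ)} (hK : IsCompact K) (hne : K.Nonempty)
    (x : Fin n → ℝ) : ∃ y ∈ K, ∀ z ∈ K, ∑ i, (x i - y i) ^ 2 ≤ ∑ i, (x i - z i) ^ 2 := by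
  obtain ⟨y, hy, hmin⟩ := hK.exists_isMinOn hne (continuous_sum_sq_sub x).continuousOn
  exact ⟨y, hy, fun z hz => hmin hz⟩

/-- **Uniqueness of the nearest point in a convex set** (the midpoint of two minimisers would be
strictly nearer). [folklore] -/
theorem eq_of_isMinOn_sum_sq {K : Set (Fin n → ℝ)} (hKc : Convex ℝ K) (x : Fin n → ℝ)
    {y y' : Fin n → ℝ} (hy : y ∈ K) (hy' : y' ∈ K)
    (hmin : ∀ z ∈ K, ∑ i, (x i - y i) ^ 2 ≤ ∑ i, (x i - z i) ^ 2)
    (hmin' : ∀ z ∈ K, ∑ i, (x i - y' i) ^ 2 ≤ ∑ i, (x i - z i) ^ 2) : y = y' := by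
  have hmid : (1 / 2 : ℝ) • y + (1 / 2 : ℝ) • y' ∈ K :=
    hKc hy hy' (by norm_num) (by norm_num) (by norm_num)
  have h1 := hmin _ hmid
  have h2 := hmin' _ hmid
  rw [sum_sq_midpoint] at h1 h2
  have hyy' : ∑ i, (y i - y' i) ^ 2 ≤ 0 := by linarith
  have h0 : ∑ i, (y i - y' i) ^ 2 = 0 :=
    le_antisymm hyy' (Finset.sum_nonneg fun i _ => sq_nonneg _)
  exact (sum_sq_sub_eq_zero_iff y y').1 h0

/-! ### The retraction -/

/-- **The continuous nearest-point retraction onto a non-empty compact convex `K ⊆ ℝⁿ`.** There is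
`r : ℝⁿ → ℝⁿ` continuous with `r x ∈ K`, `r x = x` on `K`, `r x` the nearest point of `K` to `x` for
the Euclidean distance, and `y = r x` for every `y ∈ K` at least as near: a first-order
characterisation of the graph of `r` (so `r` is definable in any expansion of the real field in which
`K` is). Continuity: along `xₖ → x` every cluster point of `r xₖ ∈ K` minimises `D(x, ·)` (the
distance to `K` is continuous), hence equals `r x`. [folklore] -/
theorem exists_nearestPoint_retraction {K : Set (Fin n → ℝ)} (hK : IsCompact K) (hKc : Convex ℝ K)
    (hne : K.Nonempty) :
    ∃ r : (Fin n → ℝ) → (Fin n → ℝ), Continuous r ∧ (∀ x, r x ∈ K) ∧ (∀ x ∈ K, r x = x) ∧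
      (∀ x, ∀ z ∈ K, ∑ i, (x i - r x i) ^ 2 ≤ ∑ i, (x i - z i) ^ 2) ∧
      ∀ x y, y ∈ K → (∀ z ∈ K, ∑ i, (x i - y i) ^ 2 ≤ ∑ i, (x i - z i) ^ 2) → y = r x := by
  classical
  choose r hrK hrmin using fun x => exists_isMinOn_sum_sq hK hne x
  have huniq : ∀ x y, y ∈ K → (∀ z ∈ K, ∑ i, (x i - y i) ^ 2 ≤ ∑ i, (x i - z i) ^ 2) →
      y = r x := fun x y hy hmin => eq_of_isMinOn_sum_sq hKc x hy (hrK x) hmin (hrmin x)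
  have hfix : ∀ x ∈ K, r x = x := by
    intro x hx
    refine (huniq x x hx fun z _ => ?_).symm
    simp only [sub_self, ne_eq, OfNat.ofNat_ne_zero, not_false_eq_true, zero_pow,
      Finset.sum_const_zero]
    exact Finset.sum_nonneg fun i _ => sq_nonneg _
  refine ⟨r, ?_, hrK, hfix, hrmin, huniq⟩
  -- continuity, by sequences: every subsequence of `r ∘ u` has a sub-subsequence converging to
  -- `r x`, because cluster points of `r (u k) ∈ K` minimise `D(x, ·)` (pass to the limit in
  -- `D(u k, r (u k)) ≤ D(u k, z)`)
  refine continuous_iff_seqContinuous.2 fun u x hux => ?_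
  refine tendsto_of_subseq_tendsto fun φ hφ => ?_
  obtain ⟨y, hyK, ψ, hψ, hy⟩ := hK.tendsto_subseq (fun k => hrK (u (φ k)))
  refine ⟨ψ, ?_⟩
  have hu' : Tendsto (fun k => u (φ (ψ k))) atTop (𝓝 x) :=
    hux.comp (hφ.comp hψ.tendsto_atTop)
  set v : ℕ → Fin n → ℝ := fun k => r (u (φ (ψ k))) with hv
  have hy' : Tendsto v atTop (𝓝 y) := hy
  have hvmin : ∀ k, ∀ z ∈ K, ∑ i, (u (φ (ψ k)) i - v k i) ^ 2 ≤ ∑ i, (u (φ (ψ k)) i - z i) ^ 2 :=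
    fun k z hz => hrmin _ z hz
  have hyeq : y = r x := by
    refine huniq x y hyK fun z hz => ?_
    have hlim1 : Tendsto (fun k => ∑ i, (u (φ (ψ k)) i - v k i) ^ 2) atTop
        (𝓝 (∑ i, (x i - y i) ^ 2)) := tendsto_sum_sq_of_tendsto hu' hy'
    have hlim2 : Tendsto (fun k => ∑ i, (u (φ (ψ k)) i - z i) ^ 2) atTop
        (𝓝 (∑ i, (x i - z i) ^ 2)) :=
      tendsto_sum_sq_of_tendsto hu' (tendsto_const_nhds (x := z))
    exact le_of_tendsto_of_tendsto' hlim1 hlim2 fun k => hvmin k z hz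
  rw [← hyeq]
  exact hy'

/-- **Continuous extension from a compact convex set**: a function continuous on a non-empty compact
convex `K ⊆ ℝⁿ` extends to a continuous function on `ℝⁿ`, namely `f ∘ r` for the nearest-point
retraction `r` (van den Dries 1998, Ch. 8, (2.1)–(2.3): the extension step of the triangulation
theorem, here by an explicit retraction). [cite: Dries1998, Ch. 8 (2.3)] -/
theorem exists_continuous_extension_of_isCompact_convex {K : Set (Fin n → ℝ)} (hK : IsCompact K)
    (hKc : Convex ℝ K) (hne : K.Nonempty) {β : Type*} [TopologicalSpace β] {f : (Fin n → ℝ) → β}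
    (hf : ContinuousOn f K) :
    ∃ r : (Fin n → ℝ) → (Fin n → ℝ), Continuous (f ∘ r) ∧ EqOn (f ∘ r) f K ∧ (∀ x, r x ∈ K) ∧
      ∀ x y, y ∈ K → (∀ z ∈ K, ∑ i, (x i - y i) ^ 2 ≤ ∑ i, (x i - z i) ^ 2) → y = r x := by
  obtain ⟨r, hrc, hrK, hfix, -, huniq⟩ := exists_nearestPoint_retraction hK hKc hne
  refine ⟨r, ?_, fun x hx => by simp [hfix x hx], hrK, huniq⟩
  exact hf.comp_continuous hrc hrK

end Literature.Analysis.Convexity
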